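import Mathlib
import Literature.Analysis.SpecialFunctions.LegendrePolynomials
import Literature.Analysis.SpecialFunctions.LegendrePolynomialsBonnet
import Literature.Analysis.SpecialFunctions.LegendreZeros
import Literature.Analysis.SpecialFunctions.GaussLegendreQuadrature
import HarnessLib

/-!
# Legendre polynomials: the differential relation `(x² - 1) P_n' = n x P_n - n P_{n-1}`, Bonnet's
# recursion differentiated, and the second Gauss–Legendre weight formula

Proved continuation of `LegendrePolynomials.lean` (Rodrigues definition `legendre n`),
`LegendrePolynomialsBonnet.lean` (Bonnet's recursion `legendre_succ_succ`, parity
`eval_neg_legendre`) and `GaussLegendreQuadrature.lean` (nodes `gaussLegendreNodes`, Christoffel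
numbers `gaussLegendreWeight`, closed form `gaussLegendreWeight_eq`). Everything here is PROVED; no
named fact, no axiom.

* `derivative_legendre_succ_succ`, `eval_derivative_legendre_add_two`, `eval_legendre_add_two` —
  Bonnet's recursion `(k+2) P_{k+2} = (2k+3) x P_{k+1} - (k+1) P_k` [Jeffrey §18.2.5.1 (1)] at a
  point and differentiated, `(k+2) P'_{k+2} = (2k+3)(P_{k+1} + x P'_{k+1}) - (k+1) P'_k`: the pair of
  recurrences by which `(P_n(x), P_n'(x))` is evaluated in rational or interval arithmetic;
* `X_sq_sub_one_mul_derivative_legendre` — **the differential relation**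
  `(x² - 1) P'_{n+1} = (n+1)(x P_{n+1} - P_n)` in `ℝ[X]` [Jeffrey §18.2.5.1 (2), with `n ↦ n+1`],
  and its evaluated form `eval_X_sq_sub_one_mul_derivative_legendre`.  PROOF (not the printed
  derivations from the generating function or from orthogonality): with
  `D_k := (1 - X²) P_k' + k X P_k - k P_{k-1}`, Bonnet's recursion for `P_{k+2}`, its derivative, and
  Bonnet's recursion for `P_{k+1}` give the polynomial identity
  `(k+2) D_{k+2} = (2k+3) X D_{k+1} - (k+1) D_k` (checked by `linear_combination`), so `D_k = 0` by
  two-step induction from `D_0 = D_1 = 0`;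
* at a node `x` of the `(n+1)`-point rule (`P_{n+1}(x) = 0`):
  `one_sub_sq_mul_eval_derivative_legendre_of_mem_gaussLegendreNodes`
  (`(1 - x²) P'_{n+1}(x) = (n+1) P_n(x)`), `eval_legendre_ne_zero_of_mem_gaussLegendreNodes_succ`
  (`P_n(x) ≠ 0`), and **the second weight formula** `gaussLegendreWeight_eq_of_legendre_pred`:
  `λ_x = 2(1 - x²) / ((n+1)² P_n(x)²)` — equal at the nodes to the Christoffel form
  `2 / ((1 - x²) P'_{n+1}(x)²)` [Abramowitz–Stegun 25.4.29];
* `neg_mem_gaussLegendreNodes_iff` (`-x` is a node iff `x` is, from parity) and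
  `zero_mem_gaussLegendreNodes_of_odd` (`0` is a node for odd `n`).

Motivation and first use: these are exactly the identities a certified Gauss–Legendre engine
evaluates — the H21 engines group's `cap.special.gauss_legendre(n, prec)` computes each weight on the
certified node interval by BOTH formulas and returns their intersection (an internal two-formula
check), produces the nodes for `x > 0` and mirrors them, and returns `[0, 0]` for odd `n`; the
companion file `Literature/Analysis/ValidatedNumerics/SignChangeRootIsolation.lean` proves the node
certification itself.  Shared numerical engines serve client cells; rigour lives in the verifiers;
nothing in this file is a claim about any engine output.

NOT here: the relations `P'_{n+1} - x P'_n = (n+1) P_n`, `(P_{n+1} - P_{n-1})' = (2n+1) P_n`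
(Jeffrey §18.2.5.1 (3)–(5)), which follow the same way; asymptotics of nodes or weights.

## References

* A. Jeffrey, *Handbook of Mathematical Formulas and Integrals*, Academic Press 1995, §18.2.5.1
  (1)–(2) (held copy, p. 179). [cite: Jeffrey1995, §18.2.5.1 (2)]
* M. Abramowitz, I. A. Stegun, *Handbook of Mathematical Functions*, NBS 1964, 25.4.29.
  [cite: AbramowitzStegun1964, 25.4.29]
* G. Szegő, *Orthogonal Polynomials*, AMS Colloquium Publications 23 (1939; 4th ed. 1975), (4.1.3)
  (Jacobi symmetry; `α = β = 0` is the parity of `P_n`) and §3.3 (5) (consecutive orthogonal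
  polynomials have no common zero). [cite: Szego1939, §3.3 (5)]

AI-produced formalisation (H21 engines group, seat eng-cap-1 gen 18, 2026-08-21); no facts, no
axioms, no `sorry`.
-/

noncomputable section

open Polynomial Set Finset

namespace Literature.Analysis.SpecialFunctions

/-- **Mirror symmetry of the nodes** (`P_n(-x) = (-1)ⁿ P_n(x)`): `-x` is a node iff `x` is — the
engine certifies the nodes `x > 0` and mirrors them exactly. [cite: Szego1939, (4.1.3) (α = β = 0)] -/
theorem neg_mem_gaussLegendreNodes_iff {n : ℕ} {x : ℝ} :
    -x ∈ gaussLegendreNodes n ↔ x ∈ gaussLegendreNodes n := by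
  rw [mem_gaussLegendreNodes_iff, mem_gaussLegendreNodes_iff, IsRoot.def, IsRoot.def,
    eval_neg_legendre]
  have h : ((-1 : ℝ) ^ n) ≠ 0 := pow_ne_zero _ (by norm_num)
  constructor
  · intro h0
    rcases mul_eq_zero.mp h0 with h1 | h1
    · exact absurd h1 h
    · exact h1
  · intro h0; rw [h0, mul_zero]

/-- For odd `n`, `0` is a node (`P_n(0) = -P_n(0)`); the engine returns it as the point interval
`[0, 0]`. [cite: Szego1939, (4.1.3) (α = β = 0)] -/
theorem zero_mem_gaussLegendreNodes_of_odd {n : ℕ} (hn : Odd n) : (0 : ℝ) ∈ gaussLegendreNodes n := by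
  rw [mem_gaussLegendreNodes_iff, IsRoot.def]
  have h := eval_neg_legendre n 0
  rw [neg_zero, hn.neg_one_pow] at h
  linarith

/-! ### The recurrences the engine evaluates (Bonnet, and Bonnet differentiated) -/

/-- Bonnet's recursion at a point: `(k+2) P_{k+2}(x) = (2k+3) x P_{k+1}(x) - (k+1) P_k(x)` — the
loop of `legendre_pd_exact` / `legendre_triplet` (there with `k+1 ↦ k`).
[cite: Jeffrey1995, §18.2.5.1 (1)] -/
theorem eval_legendre_add_two (k : ℕ) (x : ℝ) :
    ((k : ℝ) + 2) * (legendre (k + 2)).eval x =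
      (2 * (k : ℝ) + 3) * x * (legendre (k + 1)).eval x - ((k : ℝ) + 1) * (legendre k).eval x := by
  have h := congrArg (fun q => q.eval x) (legendre_succ_succ k)
  simpa only [eval_mul, eval_C, eval_X, eval_sub] using h

/-- Bonnet's recursion differentiated:
`(k+2) P'_{k+2} = (2k+3) (P_{k+1} + X P'_{k+1}) - (k+1) P'_k` — the derivative line of
`legendre_pd_exact` / `legendre_triplet`. [cite: Jeffrey1995, §18.2.5.1 (1)] -/
theorem derivative_legendre_succ_succ (k : ℕ) :
    C ((k : ℝ) + 2) * derivative (legendre (k + 2)) =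
      C (2 * (k : ℝ) + 3) * (legendre (k + 1) + X * derivative (legendre (k + 1))) -
        C ((k : ℝ) + 1) * derivative (legendre k) := by
  have h := congrArg derivative (legendre_succ_succ k)
  simp only [derivative_mul, derivative_C, zero_mul, zero_add, derivative_X, mul_one,
    derivative_sub] at h
  rw [h]; ring

/-- The same at a point: `(k+2) P'_{k+2}(x) = (2k+3) (P_{k+1}(x) + x P'_{k+1}(x)) - (k+1) P'_k(x)`.
[cite: Jeffrey1995, §18.2.5.1 (1)] -/
theorem eval_derivative_legendre_add_two (k : ℕ) (x : ℝ) :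
    ((k : ℝ) + 2) * (derivative (legendre (k + 2))).eval x =
      (2 * (k : ℝ) + 3) * ((legendre (k + 1)).eval x + x * (derivative (legendre (k + 1))).eval x) -
        ((k : ℝ) + 1) * (derivative (legendre k)).eval x := by
  have h := congrArg (fun q => q.eval x) (derivative_legendre_succ_succ k)
  simpa only [eval_mul, eval_C, eval_X, eval_sub, eval_add] using h

/-! ### The differential relation `(x²-1) P_n' = n x P_n - n P_{n-1}` and the second weight formula -/

/-- Bonnet's recursion with the constants cast into `ℝ[X]` (for `linear_combination`). [folklore] -/
private theorem bonnet_cast (n : ℕ) :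
    ((n : ℝ[X]) + 2) * legendre (n + 2) =
      (2 * (n : ℝ[X]) + 3) * X * legendre (n + 1) - ((n : ℝ[X]) + 1) * legendre n := by
  have h := legendre_succ_succ n
  simpa only [map_add, map_mul, map_natCast, map_ofNat, map_one] using h

/-- Bonnet's recursion differentiated, cast form. [folklore] -/
private theorem bonnet_derivative_cast (n : ℕ) :
    ((n : ℝ[X]) + 2) * derivative (legendre (n + 2)) =
      (2 * (n : ℝ[X]) + 3) * (legendre (n + 1) + X * derivative (legendre (n + 1))) -
        ((n : ℝ[X]) + 1) * derivative (legendre n) := by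
  have h := derivative_legendre_succ_succ n
  simpa only [map_add, map_mul, map_natCast, map_ofNat, map_one] using h

/-- Bonnet one index down, valid for every `n` (for `n = 0` it reads `P_1 = X P_0`). [folklore] -/
private theorem bonnet_cast' (n : ℕ) :
    ((n : ℝ[X]) + 1) * legendre (n + 1) =
      (2 * (n : ℝ[X]) + 1) * X * legendre n - (n : ℝ[X]) * legendre (n - 1) := by
  rcases n with _ | m
  · simp [legendre_one, legendre_zero]
  · have h := bonnet_cast m
    simp only [Nat.cast_succ, Nat.add_sub_cancel]
    linear_combination h

/-- `D_k := (1 - X²) P_k' + k X P_k - k P_{k-1} = 0` for every `k`, by two-step induction on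
Bonnet's recursion (module docstring). [folklore] -/
private theorem diffrel_aux : ∀ k : ℕ,
    (1 - X ^ 2) * derivative (legendre k) + (k : ℝ[X]) * X * legendre k -
      (k : ℝ[X]) * legendre (k - 1) = 0 := by
  intro k
  induction k using Nat.twoStepInduction with
  | zero => simp [legendre_zero]
  | one => rw [Nat.sub_self, legendre_one, legendre_zero, derivative_X, Nat.cast_one]; ring
  | more n h0 h1 =>
    simp only [Nat.cast_add, Nat.cast_one, Nat.add_sub_cancel] at h1
    simp only [Nat.cast_add, Nat.cast_ofNat]
    have hB2 := bonnet_cast n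
    have hB2' := bonnet_derivative_cast n
    have hB1 := bonnet_cast' n
    have key : ((n : ℝ[X]) + 2) * ((1 - X ^ 2) * derivative (legendre (n + 2)) +
        ((n : ℝ[X]) + 2) * X * legendre (n + 2) - ((n : ℝ[X]) + 2) * legendre (n + 1)) = 0 := by
      linear_combination (1 - X ^ 2) * hB2' + ((n : ℝ[X]) + 2) * X * hB2 +
        (2 * (n : ℝ[X]) + 3) * X * h1 - ((n : ℝ[X]) + 1) * h0 - ((n : ℝ[X]) + 1) * hB1
    have hne : ((n : ℝ[X]) + 2) ≠ 0 := by
      rw [show ((n : ℝ[X]) + 2) = C ((n : ℝ) + 2) by rw [map_add, map_natCast, map_ofNat]]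
      exact C_ne_zero.mpr (by positivity)
    exact (mul_eq_zero.mp key).resolve_left hne

/-- **The differential relation of the Legendre polynomials**:
`(x² - 1) P'_{n+1} = (n+1) (x P_{n+1} - P_n)` as a polynomial identity (Jeffrey §18.2.5.1 (2):
`(x²-1) dP_n/dx = n x P_n - n P_{n-1}`, here with `n+1 ↦ n`). Proved from Bonnet's recursion by a
two-step induction. [cite: Jeffrey1995, §18.2.5.1 (2)] -/
theorem X_sq_sub_one_mul_derivative_legendre (n : ℕ) :
    (X ^ 2 - 1) * derivative (legendre (n + 1)) =
      ((n : ℝ[X]) + 1) * (X * legendre (n + 1) - legendre n) := by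
  have h := diffrel_aux (n + 1)
  simp only [Nat.cast_add, Nat.cast_one, Nat.add_sub_cancel] at h
  linear_combination (-1 : ℝ[X]) * h

/-- The differential relation at a point: `(x² - 1) P'_{n+1}(x) = (n+1)(x P_{n+1}(x) - P_n(x))`.
[cite: Jeffrey1995, §18.2.5.1 (2)] -/
theorem eval_X_sq_sub_one_mul_derivative_legendre (n : ℕ) (x : ℝ) :
    (x ^ 2 - 1) * (derivative (legendre (n + 1))).eval x =
      ((n : ℝ) + 1) * (x * (legendre (n + 1)).eval x - (legendre n).eval x) := by
  have h := congrArg (fun q => q.eval x) (X_sq_sub_one_mul_derivative_legendre n)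
  simpa only [eval_mul, eval_sub, eval_pow, eval_X, eval_one, eval_add, eval_natCast] using h

/-- At a Gauss–Legendre node `x` of order `n+1`: `(1 - x²) P'_{n+1}(x) = (n+1) P_n(x)`.
[cite: Jeffrey1995, §18.2.5.1 (2)] -/
theorem one_sub_sq_mul_eval_derivative_legendre_of_mem_gaussLegendreNodes {n : ℕ} {x : ℝ}
    (hx : x ∈ gaussLegendreNodes (n + 1)) :
    (1 - x ^ 2) * (derivative (legendre (n + 1))).eval x = ((n : ℝ) + 1) * (legendre n).eval x := by
  have h := eval_X_sq_sub_one_mul_derivative_legendre n x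
  have h0 : (legendre (n + 1)).eval x = 0 := (mem_gaussLegendreNodes_iff.mp hx)
  rw [h0, mul_zero, zero_sub] at h
  linarith

/-- At a node of order `n+1`, `P_n(x) ≠ 0` (consecutive Legendre polynomials have no common
zero: Szegő §3.3 (5), first consequence of (3.3.6); here read off the differential relation and
`P'_{n+1}(x) ≠ 0`). [cite: Szego1939, §3.3 (5)] -/
theorem eval_legendre_ne_zero_of_mem_gaussLegendreNodes_succ {n : ℕ} {x : ℝ}
    (hx : x ∈ gaussLegendreNodes (n + 1)) : (legendre n).eval x ≠ 0 := by
  intro h0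
  have h := one_sub_sq_mul_eval_derivative_legendre_of_mem_gaussLegendreNodes hx
  rw [h0, mul_zero] at h
  have hxI := mem_Ioo_of_mem_gaussLegendreNodes hx
  have h1 : 0 < 1 - x ^ 2 := by nlinarith [hxI.1, hxI.2]
  have h2 := eval_derivative_legendre_ne_zero_of_mem_gaussLegendreNodes hx
  rcases mul_eq_zero.mp h with h3 | h3
  · exact absurd h3 h1.ne'
  · exact h2 h3

/-- **The second weight formula** used by `cap.special.gauss_legendre` (`W2`, intersected with the
Christoffel form `W1 = 2/((1-x²)P'_{n+1}(x)²)` of `gaussLegendreWeight_eq`): at a node `x` of the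
`(n+1)`-point rule, `λ_x = 2 (1 - x²) / ((n+1)² P_n(x)²)` (substitute `(1 - x²) P'_{n+1}(x) = (n+1) P_n(x)` into the
Christoffel form). [cite: AbramowitzStegun1964, 25.4.29] [cite: Jeffrey1995, §18.2.5.1 (2)] -/
theorem gaussLegendreWeight_eq_of_legendre_pred {n : ℕ} {x : ℝ}
    (hx : x ∈ gaussLegendreNodes (n + 1)) :
    gaussLegendreWeight (n + 1) x =
      2 * (1 - x ^ 2) / (((n : ℝ) + 1) ^ 2 * ((legendre n).eval x) ^ 2) := by
  have hw := gaussLegendreWeight_eq hx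
  have hd := one_sub_sq_mul_eval_derivative_legendre_of_mem_gaussLegendreNodes hx
  have hxI := mem_Ioo_of_mem_gaussLegendreNodes hx
  have h1 : 0 < 1 - x ^ 2 := by nlinarith [hxI.1, hxI.2]
  have hP := eval_legendre_ne_zero_of_mem_gaussLegendreNodes_succ hx
  have hsq : (((n : ℝ) + 1) ^ 2 * ((legendre n).eval x) ^ 2) =
      (1 - x ^ 2) ^ 2 * ((derivative (legendre (n + 1))).eval x) ^ 2 := by
    rw [← mul_pow, ← mul_pow, hd]
  rw [hw, hsq]
  field_simp

end Literature.Analysis.SpecialFunctions
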